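import Literature.MathematicalPhysics.QuantumFieldTheory.Balaban1983to89.B16DressedActionTerm

/-!
# `Balaban1983to89.B16DressedTermBackground` — [Balaban1989LargeFieldII] (1.73)–(1.75) p. 380 with a source-tilted observable attached:
# THE BACKGROUND DEPENDENCE OF THE BORN DRESSED ACTION TERM IS A COVARIANCE — its background derivative is the source-integral of the
# complex-weight covariance of the observable's OSCILLATION with the action's background sensitivity, hence the born term is LIPSCHITZ in the
# background with a constant FIRST ORDER in the source, in the oscillation of the observable, and in the sensitivity (the first COUPLING
# estimate of the dressed bookkeeping: what the NEXT renormalisation step sees of a born term)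

CITATION HEADER (lean-in-tree rule 2026-08-18).  Source: T. Bałaban, *Large field renormalization. II. Localization, exponentiation, and bounds
for the 𝐑 operation*, Commun. Math. Phys. **122**, 355–392 (1989), doi:10.1007/bf01238433 [Balaban1989LargeFieldII] (cell paper B16; held:
`paper:balaban1989-cmp122-large-field-ii`).  WHAT IS PRINTED (pp. 379–380): the representation of 𝐓′_k(X) for a regular real configuration `U`
with *"the additional small, and possible complex valued, term in the exponential"* `σ` — a function of the BACKGROUND configuration — and the
three inequalities (1.73)–(1.75) (*"|(𝐓′_k(X,(𝐔,𝐉))1)⁻¹𝐓′_k(X,(𝐔,𝐉))F| ≤ e^{3sup|σ|}sup|F|. (1.75)"*); p. 356 ll. 1–6 defers observables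
(*"deserve detailed analysis and further publication"*; CMP 198∕199 NOT HELD, acq-04355∕acq-04013).

WHY THIS FILE (HUMAN RULING D-0062, Track A; DAG node N14 = NE1′ «dressed stability, observable-attached, μ-uniform — NOT PRINTED»; seat
dag-n14-c generation 2, strategy s1, `--supports` K3).  The seat's g0 module `B16DressedActionTerm` (p453150) typed the born dressed action term
`D_t = Log 𝐓′ₜ1 − Log 𝐓′₀1` of ONE step at ONE background and its sizes; the seat's model rung `Thm/BalabanUVNodesN14DecoupledDressing*`
(p459546, p461345) booked such terms on a SCALE-DECOUPLED tower, where — SAID there — the inter-scale TRANSPORT of a born term is vacuous.  In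
Bałaban's scheme the step's exponent depends on the next background `U`; the born term `D_t(U)` is then a function of `U`, and what the NEXT
step books of it is its OSCILLATION over the next fluctuation of `U` (g0's `norm_dressLog_sub_mul_le`: a normalised step is blind to constants).
This file proves, in [B16]'s own currency and for a background entering the exponent LINEARLY through a bounded sensitivity `A`
(`σ_u = σ + u·A`, `‖A‖ ≤ α`, `u` in a complex disc — the first-order model of *"a function of the background"*; NOT asserted for Bałaban's σ):
* §1 `dressLogAt μ ρ₀ σ A W u t := dressLog μ ρ₀ (σ + u·A) W t` — the born term AT BACKGROUND PARAMETER `u`; `dressLogAt_zero_source` (no source ⇒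
  no born term at ANY background — the reason the background dependence is first order in the source); the four-normalisation identity
  `dressLogAt_sub_dressLogAt_zero`: `D_t(u) − D_t(0) = dressLog(σ + tW; A; u) − dressLog(σ; A; u)` (exponents commute).
* §2 `hasDerivAt_dressLogAt`: on the joint tilt disc `s + |u|α + |t|B ≤ 1` the born term is holomorphic in the background parameter with
  `∂_u D_t(u) = E^{σ+uA}_t[A] − E^{σ+uA}_0[A]` — the tilted minus the untilted normalised expectation of the SENSITIVITY (g0's logarithmic
  derivative `hasDerivAt_dressLog` twice, in the direction `A`).
* §3 `norm_tiltedMean_sensitivity_sub_le`: that difference is the source-integral of the COVARIANCE `Cov^{σ+uA}_τ(W − c, A)` (the sibling's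
  `hasDerivAt_tiltedMean`, the tilt direction shifted by the constant `c` via `tiltedMean_add_const`), bounded by the sibling's (1.75)ₜ covariance
  bound `norm_tiltedCov_le`: `‖E_t[A] − E_0[A]‖ ≤ 2·α·B₀·e^{6(s+|u|α+|t|B₀)}·|t|` whenever `‖W − c‖ ≤ B₀` — only the OSCILLATION `B₀` of the
  observable enters, not its size.
* §4 **`norm_dressLogAt_sub_le`**: on the background disc `|u|, |u′| ≤ r` (joint discs `s + rα + |t|B ≤ 1`, `s + rα + |t|B₀ ≤ 1`)
  `‖D_t(u) − D_t(u′)‖ ≤ 2·α·B₀·e^{6(s+rα+|t|B₀)}·|t|·|u − u′|` — THE BORN TERM IS LIPSCHITZ IN THE BACKGROUND with a constant FIRST ORDER in the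
  source radius, in the observable's oscillation and in the action's sensitivity (mean value inequality in `u`); `norm_dressLogAt_sub_center_le`
  (oscillation over the disc about its centre value `≤ … · r`).  In the cell's bookkeeping `B₀ = C_W·θ^{K−k}` (`T4AvgSensitivity.LoopOscBound`):
  the VARIATION of a born term over the next background window — what the next step books of it — is again geometric in the age of the birth,
  the estimate a COUPLED dressed tower's transport leaf consumes (row NE1′ END-F binder `ExponentSliceAt`'s oscillation margin, for the dressed part).

HONEST FRAMING.  (1.73)–(1.75) are printed for the ACTION's representation only; the dressed objects and the linear background model are NOT
PRINTED in [B16]; every declaration below is a definition, an algebraic identity of the cited normalisations, or folklore complex calculus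
(logarithmic derivative, covariance as source-derivative, two mean value inequalities) about the integrals of the cited displays, whose locator is
the tag.  Nothing is asserted about Bałaban's densities: `μ`, `ρ₀`, `σ`, `A`, `W`, `c` are arbitrary data under the displayed hypotheses; whether
the genuine 𝐓′_k(X,(𝐔,𝐉)) with the loop observable attached meet them (and with which `α`, `B₀` per scale) is the node's OBJECT-level content
(NODE O).  Not a discharge of N14; count-neutral; nothing continuum ∕ ℝ⁴ ∕ OS ∕ mass-gap ∕ Clay.  0 sorry, axioms standard; no existing module is
modified; imports the seat's `B16DressedActionTerm` only.
-/

noncomputable section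

namespace Literature.MathematicalPhysics.QuantumFieldTheory.Balaban1983to89.B16DressedTermBackground

open _root_.MeasureTheory _root_.Filter _root_.Metric _root_.Set
open scoped _root_.Topology
open Literature.MathematicalPhysics.QuantumFieldTheory.Balaban1983to89.T4TrajectoryDensity
open Literature.MathematicalPhysics.QuantumFieldTheory.Balaban1983to89.B16Ineq175Tilted
open Literature.MathematicalPhysics.QuantumFieldTheory.Balaban1983to89.B16DressedActionTerm

variable {Z : Type*}

/-! ## §1 The born term at a background parameter; the four-normalisation identity -/

/-- **THE BORN DRESSED ACTION TERM AT BACKGROUND PARAMETER `u`** — `D_t(u) := Log 𝐓′ₜ1 − Log 𝐓′₀1` for the step whose small exponential term is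
`σ + u·A` (the background enters linearly through the bounded SENSITIVITY `A`; first-order model of *"σ … for the configuration U"*, p. 379) with
the observable `W` attached through the source `t` (g0's `dressLog` at base exponent `σ + u·A`).  NOT PRINTED (p. 356 defers observables). [folklore] -/
def dressLogAt [MeasurableSpace Z] (μ : Measure Z) (ρ₀ : Z → ℝ) (σ A W : Z → ℂ) (u t : ℂ) : ℂ :=
  dressLog μ ρ₀ (fun z => σ z + u * A z) W t

/-- **NO SOURCE, NO BORN TERM — AT EVERY BACKGROUND**: `D_0(u) = 0`.  (This is why the background dependence of the born term is first order in
the source: `D_t(u) − D_t(u′)` vanishes identically at `t = 0`.) (NOT PRINTED as a display: bookkeeping on the normalisation of the cited (1.74).)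
[cite: Balaban1989LargeFieldII, (1.74) p.380] -/
theorem dressLogAt_zero_source [MeasurableSpace Z] (μ : Measure Z) (ρ₀ : Z → ℝ) (σ A W : Z → ℂ) (u : ℂ) :
    dressLogAt μ ρ₀ σ A W u 0 = 0 :=
  dressLog_zero μ ρ₀ _ W

/-- Two tilted normalisations with pointwise equal exponents agree. [folklore] -/
private theorem tiltNorm_congr [MeasurableSpace Z] (μ : Measure Z) (ρ₀ : Z → ℝ) {σ₁ σ₂ W₁ W₂ : Z → ℂ} {t₁ t₂ : ℂ}
    (h : ∀ z, σ₁ z + t₁ * W₁ z = σ₂ z + t₂ * W₂ z) : tiltNorm μ ρ₀ σ₁ W₁ t₁ = tiltNorm μ ρ₀ σ₂ W₂ t₂ := by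
  simp only [tiltNorm_def, tiltWeight_apply]
  exact integral_congr_ae (Eventually.of_forall fun z => by simp only [h z])

/-- Two tilted weights with pointwise equal exponents agree, hence so do the tilted normalised expectations. [folklore] -/
private theorem tiltedMean_congr [MeasurableSpace Z] {F : Type*} [NormedAddCommGroup F] [NormedSpace ℂ F] (μ : Measure Z) (ρ₀ : Z → ℝ)
    {σ₁ σ₂ W₁ W₂ : Z → ℂ} {t₁ t₂ : ℂ} (h : ∀ z, σ₁ z + t₁ * W₁ z = σ₂ z + t₂ * W₂ z) (g : Z → F) :
    tiltedMean μ ρ₀ σ₁ W₁ g t₁ = tiltedMean μ ρ₀ σ₂ W₂ g t₂ := by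
  have hw : tiltWeight ρ₀ σ₁ W₁ t₁ = tiltWeight ρ₀ σ₂ W₂ t₂ := by
    funext z; rw [tiltWeight_apply, tiltWeight_apply, h z]
  simp only [tiltedMean, hw]

/-- **THE FOUR-NORMALISATION IDENTITY**: `D_t(u) − D_t(0) = dressLog(σ + tW; A; u) − dressLog(σ; A; u)` — moving the background at fixed source
equals tilting in the SENSITIVITY direction `A` with and without the source (the exponents `σ + uA + tW` commute; an identity of differences of
the same four principal logarithms, no branch question). (NOT PRINTED as a display: algebra of the normalisations of the cited (1.74).)
[cite: Balaban1989LargeFieldII, (1.74) p.380] -/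
theorem dressLogAt_sub_dressLogAt_zero [MeasurableSpace Z] (μ : Measure Z) (ρ₀ : Z → ℝ) (σ A W : Z → ℂ) (u t : ℂ) :
    dressLogAt μ ρ₀ σ A W u t - dressLogAt μ ρ₀ σ A W 0 t =
      dressLog μ ρ₀ (fun z => σ z + t * W z) A u - dressLog μ ρ₀ σ A u := by
  have e1 : tiltNorm μ ρ₀ (fun z => σ z + u * A z) W t = tiltNorm μ ρ₀ (fun z => σ z + t * W z) A u :=
    tiltNorm_congr μ ρ₀ fun z => by ring
  have e2 : tiltNorm μ ρ₀ (fun z => σ z + u * A z) W 0 = tiltNorm μ ρ₀ σ A u :=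
    tiltNorm_congr μ ρ₀ fun z => by ring
  have e3 : tiltNorm μ ρ₀ (fun z => σ z + 0 * A z) W t = tiltNorm μ ρ₀ (fun z => σ z + t * W z) A 0 :=
    tiltNorm_congr μ ρ₀ fun z => by ring
  have e4 : tiltNorm μ ρ₀ (fun z => σ z + 0 * A z) W 0 = tiltNorm μ ρ₀ σ A 0 :=
    tiltNorm_congr μ ρ₀ fun z => by ring
  simp only [dressLogAt, dressLog, e1, e2, e3, e4]
  ring

/-- A positive base mass forces `μ ≠ 0`, so an a.e. norm bound is witnessed somewhere: its constant is nonnegative. [folklore] -/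
private theorem nonneg_of_ae_norm_le'' [MeasurableSpace Z] {μ : Measure Z} {ρ₀ : Z → ℝ} {g : Z → ℂ} {b : ℝ}
    (hP : 0 < ∫ z, ρ₀ z ∂μ) (hg : ∀ᵐ z ∂μ, ‖g z‖ ≤ b) : 0 ≤ b := by
  have hμ : μ ≠ 0 := by
    intro h0; rw [h0, integral_zero_measure] at hP; exact lt_irrefl _ hP
  haveI : (ae μ).NeBot := ae_neBot.mpr hμ
  obtain ⟨z, hz⟩ := hg.exists
  exact (norm_nonneg _).trans hz

variable [MeasurableSpace Z] {μ : Measure Z} {ρ₀ : Z → ℝ} {σ W A : Z → ℂ} {s B B₀ α : ℝ} {c : ℂ}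

/-- The base exponent moved by the background, `σ + u·A`, is a.e.-strongly measurable. [folklore] -/
private theorem aesm_base (hσm : AEStronglyMeasurable σ μ) (hAm : AEStronglyMeasurable A μ) (u : ℂ) :
    AEStronglyMeasurable (fun z => σ z + u * A z) μ :=
  hσm.add (aestronglyMeasurable_const.mul hAm)

/-- … and bounded by `s + |u|·α` a.e. [folklore] -/
private theorem ae_base_le (hσ : ∀ᵐ z ∂μ, ‖σ z‖ ≤ s) (hA : ∀ᵐ z ∂μ, ‖A z‖ ≤ α) (u : ℂ) :
    ∀ᵐ z ∂μ, ‖σ z + u * A z‖ ≤ s + ‖u‖ * α := by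
  filter_upwards [hσ, hA] with z hz hAz
  exact (norm_add_le _ _).trans (add_le_add hz (by rw [norm_mul]; exact mul_le_mul_of_nonneg_left hAz (norm_nonneg _)))

/-! ## §2 Holomorphy in the background: the derivative is a difference of two normalised expectations of the sensitivity -/

/-- **THE BACKGROUND DERIVATIVE OF THE BORN TERM**: on the joint tilt disc `s + |u|·α + |t|·B ≤ 1`, `u ↦ D_t(u)` is complex-differentiable with
`∂_u D_t(u) = E^{σ+tW}_{A,u}[A] − E^{σ}_{A,u}[A]` — the normalised expectation of the SENSITIVITY under the weight WITH the source minus the one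
WITHOUT it (g0's logarithmic derivative `hasDerivAt_dressLog` in the direction `A`, twice, through §1's identity). (NOT PRINTED as a display:
folklore calculus on the normalisations of the cited (1.74)∕(1.75), whose locator is the tag.) [cite: Balaban1989LargeFieldII, (1.75) p.380] -/
theorem hasDerivAt_dressLogAt (hρ : Integrable ρ₀ μ) (hρ0 : 0 ≤ᵐ[μ] ρ₀) (hP : 0 < ∫ z, ρ₀ z ∂μ)
    (hσm : AEStronglyMeasurable σ μ) (hWm : AEStronglyMeasurable W μ) (hAm : AEStronglyMeasurable A μ)
    (hσ : ∀ᵐ z ∂μ, ‖σ z‖ ≤ s) (hW : ∀ᵐ z ∂μ, ‖W z‖ ≤ B) (hA : ∀ᵐ z ∂μ, ‖A z‖ ≤ α) {u t : ℂ}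
    (hut : s + ‖u‖ * α + ‖t‖ * B ≤ 1) :
    HasDerivAt (fun v : ℂ => dressLogAt μ ρ₀ σ A W v t)
      (tiltedMean μ ρ₀ (fun z => σ z + t * W z) A A u - tiltedMean μ ρ₀ σ A A u) u := by
  have hB : 0 ≤ B := nonneg_of_ae_norm_le'' hP hW
  -- the base with the source, `σ + tW`, bounded by `s + |t|B`; the disc in the direction `A`
  have hσtm : AEStronglyMeasurable (fun z => σ z + t * W z) μ := hσm.add (aestronglyMeasurable_const.mul hWm)
  have hσt : ∀ᵐ z ∂μ, ‖σ z + t * W z‖ ≤ s + ‖t‖ * B := ae_base_le hσ hW t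
  have h1 : (s + ‖t‖ * B) + ‖u‖ * α ≤ 1 := by linarith
  have h0 : s + ‖u‖ * α ≤ 1 := by nlinarith [norm_nonneg t]
  have hD1 := hasDerivAt_dressLog hρ hρ0 hP hσtm hAm hσt hA h1
  have hD0 := hasDerivAt_dressLog hρ hρ0 hP hσm hAm hσ hA h0
  have hfun : (fun v : ℂ => dressLogAt μ ρ₀ σ A W v t) = fun v =>
      dressLogAt μ ρ₀ σ A W 0 t + (dressLog μ ρ₀ (fun z => σ z + t * W z) A v - dressLog μ ρ₀ σ A v) := by
    funext v
    rw [← dressLogAt_sub_dressLogAt_zero, add_sub_cancel]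
  rw [hfun]
  exact (hD1.sub hD0).const_add _

/-! ## §3 The difference of the two expectations of the sensitivity is a source-integral of covariances -/

/-- **ONLY THE OSCILLATION OF THE OBSERVABLE MOVES THE EXPECTATION OF THE SENSITIVITY**: on the disc `s + |u|α + |t|B₀ ≤ 1` with `‖W − c‖ ≤ B₀`,
`‖E^{σ+tW}_{A,u}[A] − E^{σ}_{A,u}[A]‖ ≤ 2·α·B₀·e^{6(s+|u|α+|t|B₀)}·|t|`.  Proof: regrouping the exponents, both are values at `τ = t` and `τ = 0` of
`τ ↦ E^{σ+uA}_{W,τ}[A]`, which equals `E^{σ+uA}_{W−c,τ}[A]` (a constant shift of the tilt direction cancels, `tiltedMean_add_const`) and has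
derivative the COVARIANCE `Cov^{σ+uA}_{W−c,τ}(A)` (the sibling's `hasDerivAt_tiltedMean`) bounded by the sibling's (1.75)ₜ covariance bound
`norm_tiltedCov_le` with the oscillation `B₀` in place of the observable's size; then the mean value inequality on `[0, t]`. (NOT PRINTED as a
display: folklore calculus about the normalised operation of the cited (1.75), whose locator is the tag.) [cite: Balaban1989LargeFieldII, (1.75) p.380] -/
theorem norm_tiltedMean_sensitivity_sub_le (hρ : Integrable ρ₀ μ) (hρ0 : 0 ≤ᵐ[μ] ρ₀) (hP : 0 < ∫ z, ρ₀ z ∂μ)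
    (hσm : AEStronglyMeasurable σ μ) (hWm : AEStronglyMeasurable W μ) (hAm : AEStronglyMeasurable A μ)
    (hσ : ∀ᵐ z ∂μ, ‖σ z‖ ≤ s) (hW₀ : ∀ᵐ z ∂μ, ‖W z - c‖ ≤ B₀) (hA : ∀ᵐ z ∂μ, ‖A z‖ ≤ α) {u t : ℂ}
    (hut₀ : s + ‖u‖ * α + ‖t‖ * B₀ ≤ 1) :
    ‖tiltedMean μ ρ₀ (fun z => σ z + t * W z) A A u - tiltedMean μ ρ₀ σ A A u‖ ≤
      2 * α * B₀ * Real.exp (6 * (s + ‖u‖ * α + ‖t‖ * B₀)) * ‖t‖ := by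
  have hB₀ : 0 ≤ B₀ := nonneg_of_ae_norm_le'' hP hW₀
  have hα : 0 ≤ α := nonneg_of_ae_norm_le'' hP hA
  -- the base moved by the background, and the shifted tilt direction `W − c`
  have hσum : AEStronglyMeasurable (fun z => σ z + u * A z) μ := aesm_base hσm hAm u
  have hσu : ∀ᵐ z ∂μ, ‖σ z + u * A z‖ ≤ s + ‖u‖ * α := ae_base_le hσ hA u
  have hWcm : AEStronglyMeasurable (fun z => W z - c) μ := hWm.sub aestronglyMeasurable_const
  -- Φ τ := E^{σ+uA}_{W−c,τ}[A]; its values at `t` and `0` are the two expectations of the statement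
  set Φ : ℂ → ℂ := fun τ => tiltedMean μ ρ₀ (fun z => σ z + u * A z) (fun z => W z - c) A τ with hΦ
  have hΦt : Φ t = tiltedMean μ ρ₀ (fun z => σ z + t * W z) A A u := by
    rw [hΦ]
    dsimp only
    rw [show (fun z => W z - c) = fun z => W z + (-c) from funext fun z => sub_eq_add_neg _ _, tiltedMean_add_const]
    exact tiltedMean_congr μ ρ₀ (fun z => by ring) A
  have hΦ0 : Φ 0 = tiltedMean μ ρ₀ σ A A u := by
    rw [hΦ]
    dsimp only
    rw [show (fun z => W z - c) = fun z => W z + (-c) from funext fun z => sub_eq_add_neg _ _, tiltedMean_add_const]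
    exact tiltedMean_congr μ ρ₀ (fun z => by ring) A
  -- derivative of Φ on the closed ball of radius |t|: the covariance, bounded by (1.75)ₜ with the oscillation B₀
  have hdisc : ∀ τ ∈ closedBall (0 : ℂ) ‖t‖, (s + ‖u‖ * α) + ‖τ‖ * B₀ ≤ 1 := by
    intro τ hτ
    have hτ' : ‖τ‖ ≤ ‖t‖ := by simpa using hτ
    have := mul_le_mul_of_nonneg_right hτ' hB₀
    linarith
  have hderiv : ∀ τ ∈ closedBall (0 : ℂ) ‖t‖,
      HasDerivWithinAt Φ (tiltedCov μ ρ₀ (fun z => σ z + u * A z) (fun z => W z - c) A τ) (closedBall (0 : ℂ) ‖t‖) τ :=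
    fun τ hτ => (hasDerivAt_tiltedMean (F := ℂ) hρ hρ0 hP hσum hWcm hσu hW₀ hAm hA (hdisc τ hτ)).hasDerivWithinAt
  have hbound : ∀ τ ∈ closedBall (0 : ℂ) ‖t‖,
      ‖tiltedCov μ ρ₀ (fun z => σ z + u * A z) (fun z => W z - c) A τ‖ ≤ 2 * α * B₀ * Real.exp (6 * (s + ‖u‖ * α + ‖t‖ * B₀)) := by
    intro τ hτ
    have hτ' : ‖τ‖ ≤ ‖t‖ := by simpa using hτ
    refine (norm_tiltedCov_le (F := ℂ) hρ hρ0 hP hσum hWcm hσu hW₀ hA hα (hdisc τ hτ)).trans ?_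
    have hexp : Real.exp (6 * (s + ‖u‖ * α + ‖τ‖ * B₀)) ≤ Real.exp (6 * (s + ‖u‖ * α + ‖t‖ * B₀)) :=
      Real.exp_le_exp.mpr (by nlinarith [mul_le_mul_of_nonneg_right hτ' hB₀])
    calc 2 * B₀ * Real.exp (6 * (s + ‖u‖ * α + ‖τ‖ * B₀)) * α
        ≤ 2 * B₀ * Real.exp (6 * (s + ‖u‖ * α + ‖t‖ * B₀)) * α :=
          mul_le_mul_of_nonneg_right (mul_le_mul_of_nonneg_left hexp (by positivity)) hα
      _ = 2 * α * B₀ * Real.exp (6 * (s + ‖u‖ * α + ‖t‖ * B₀)) := by ring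
  have key := (convex_closedBall (0 : ℂ) ‖t‖).norm_image_sub_le_of_norm_hasDerivWithin_le hderiv hbound
    (mem_closedBall_self (norm_nonneg t)) (by simp : t ∈ closedBall (0 : ℂ) ‖t‖)
  rw [← hΦt, ← hΦ0]
  simpa using key

/-- **THE BACKGROUND DERIVATIVE IS FIRST ORDER IN THE SOURCE AND IN THE OSCILLATION**: on the joint discs,
`‖∂_u D_t(u)‖ ≤ 2·α·B₀·e^{6(s+|u|α+|t|B₀)}·|t|` (§2 with §3). (NOT PRINTED as a display: folklore calculus on the normalisations of the cited
(1.74)∕(1.75), whose locator is the tag.) [cite: Balaban1989LargeFieldII, (1.75) p.380] -/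
theorem norm_deriv_dressLogAt_le (hρ : Integrable ρ₀ μ) (hρ0 : 0 ≤ᵐ[μ] ρ₀) (hP : 0 < ∫ z, ρ₀ z ∂μ)
    (hσm : AEStronglyMeasurable σ μ) (hWm : AEStronglyMeasurable W μ) (hAm : AEStronglyMeasurable A μ)
    (hσ : ∀ᵐ z ∂μ, ‖σ z‖ ≤ s) (hW : ∀ᵐ z ∂μ, ‖W z‖ ≤ B) (hW₀ : ∀ᵐ z ∂μ, ‖W z - c‖ ≤ B₀) (hA : ∀ᵐ z ∂μ, ‖A z‖ ≤ α)
    {u t : ℂ} (hut : s + ‖u‖ * α + ‖t‖ * B ≤ 1) (hut₀ : s + ‖u‖ * α + ‖t‖ * B₀ ≤ 1) :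
    ‖deriv (fun v : ℂ => dressLogAt μ ρ₀ σ A W v t) u‖ ≤ 2 * α * B₀ * Real.exp (6 * (s + ‖u‖ * α + ‖t‖ * B₀)) * ‖t‖ := by
  rw [(hasDerivAt_dressLogAt hρ hρ0 hP hσm hWm hAm hσ hW hA hut).deriv]
  exact norm_tiltedMean_sensitivity_sub_le hρ hρ0 hP hσm hWm hAm hσ hW₀ hA hut₀

/-! ## §4 The born term is Lipschitz in the background: first order in the source, the oscillation and the sensitivity -/

/-- Points of the closed background disc of radius `r` satisfy the joint disc conditions of radius `r`. [folklore] -/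
private theorem disc_of_mem {v t : ℂ} {r s α X : ℝ} (hα : 0 ≤ α) (hv : v ∈ closedBall (0 : ℂ) r) (h : s + r * α + ‖t‖ * X ≤ 1) :
    s + ‖v‖ * α + ‖t‖ * X ≤ 1 := by
  have hv' : ‖v‖ ≤ r := by simpa using hv
  have := mul_le_mul_of_nonneg_right hv' hα
  linarith

/-- **THE BORN DRESSED TERM IS LIPSCHITZ IN THE BACKGROUND** — for backgrounds `|u|, |u′| ≤ r` on the joint discs `s + r·α + |t|·B ≤ 1`,
`s + r·α + |t|·B₀ ≤ 1`:  `‖D_t(u) − D_t(u′)‖ ≤ 2·α·B₀·e^{6(s+rα+|t|B₀)}·|t|·|u − u′|`.  The constant is FIRST ORDER in the source radius, in the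
OSCILLATION `B₀` of the observable over the fibre (not its size) and in the SENSITIVITY `α` of the action to the background: the variation of a born
term over the next background window — what the next normalised step books of it (`norm_dressLog_sub_mul_le`: constants are not seen) — is
as small as its birth.  Mean value inequality in `u` on the convex disc with §2–§3. (NOT PRINTED as a display: folklore calculus on the
normalisations of the cited (1.74)∕(1.75), whose locator is the tag.) [cite: Balaban1989LargeFieldII, (1.75) p.380] -/
theorem norm_dressLogAt_sub_le (hρ : Integrable ρ₀ μ) (hρ0 : 0 ≤ᵐ[μ] ρ₀) (hP : 0 < ∫ z, ρ₀ z ∂μ)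
    (hσm : AEStronglyMeasurable σ μ) (hWm : AEStronglyMeasurable W μ) (hAm : AEStronglyMeasurable A μ)
    (hσ : ∀ᵐ z ∂μ, ‖σ z‖ ≤ s) (hW : ∀ᵐ z ∂μ, ‖W z‖ ≤ B) (hW₀ : ∀ᵐ z ∂μ, ‖W z - c‖ ≤ B₀) (hA : ∀ᵐ z ∂μ, ‖A z‖ ≤ α)
    {r : ℝ} {t : ℂ} (hrt : s + r * α + ‖t‖ * B ≤ 1) (hrt₀ : s + r * α + ‖t‖ * B₀ ≤ 1)
    {u u' : ℂ} (hu : ‖u‖ ≤ r) (hu' : ‖u'‖ ≤ r) :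
    ‖dressLogAt μ ρ₀ σ A W u t - dressLogAt μ ρ₀ σ A W u' t‖ ≤
      2 * α * B₀ * Real.exp (6 * (s + r * α + ‖t‖ * B₀)) * ‖t‖ * ‖u - u'‖ := by
  have hB₀ : 0 ≤ B₀ := nonneg_of_ae_norm_le'' hP hW₀
  have hα : 0 ≤ α := nonneg_of_ae_norm_le'' hP hA
  have hderiv : ∀ v ∈ closedBall (0 : ℂ) r,
      HasDerivWithinAt (fun v : ℂ => dressLogAt μ ρ₀ σ A W v t)
        (tiltedMean μ ρ₀ (fun z => σ z + t * W z) A A v - tiltedMean μ ρ₀ σ A A v) (closedBall (0 : ℂ) r) v :=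
    fun v hv => (hasDerivAt_dressLogAt hρ hρ0 hP hσm hWm hAm hσ hW hA (disc_of_mem hα hv hrt)).hasDerivWithinAt
  have hbound : ∀ v ∈ closedBall (0 : ℂ) r,
      ‖tiltedMean μ ρ₀ (fun z => σ z + t * W z) A A v - tiltedMean μ ρ₀ σ A A v‖ ≤
        2 * α * B₀ * Real.exp (6 * (s + r * α + ‖t‖ * B₀)) * ‖t‖ := by
    intro v hv
    have hv' : ‖v‖ ≤ r := by simpa using hv
    refine (norm_tiltedMean_sensitivity_sub_le hρ hρ0 hP hσm hWm hAm hσ hW₀ hA (disc_of_mem hα hv hrt₀)).trans ?_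
    have hexp : Real.exp (6 * (s + ‖v‖ * α + ‖t‖ * B₀)) ≤ Real.exp (6 * (s + r * α + ‖t‖ * B₀)) :=
      Real.exp_le_exp.mpr (by nlinarith [mul_le_mul_of_nonneg_right hv' hα])
    exact mul_le_mul_of_nonneg_right (mul_le_mul_of_nonneg_left hexp (by positivity)) (norm_nonneg _)
  have key := (convex_closedBall (0 : ℂ) r).norm_image_sub_le_of_norm_hasDerivWithin_le hderiv hbound
    (by simpa using hu') (by simpa using hu)
  simpa [mul_assoc] using key

/-- **OSCILLATION OF THE BORN TERM OVER THE BACKGROUND DISC**: for `|u| ≤ r`, `‖D_t(u) − D_t(0)‖ ≤ 2·α·B₀·e^{6(s+rα+|t|B₀)}·|t|·r` — the part of the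
born term the next normalised step books (beyond its value at the disc's centre) is first order in the source, the oscillation, the sensitivity AND
the radius of the next fluctuation window. (NOT PRINTED as a display: folklore calculus on the normalisations of the cited (1.74)∕(1.75), whose
locator is the tag.) [cite: Balaban1989LargeFieldII, (1.75) p.380] -/
theorem norm_dressLogAt_sub_center_le (hρ : Integrable ρ₀ μ) (hρ0 : 0 ≤ᵐ[μ] ρ₀) (hP : 0 < ∫ z, ρ₀ z ∂μ)
    (hσm : AEStronglyMeasurable σ μ) (hWm : AEStronglyMeasurable W μ) (hAm : AEStronglyMeasurable A μ)
    (hσ : ∀ᵐ z ∂μ, ‖σ z‖ ≤ s) (hW : ∀ᵐ z ∂μ, ‖W z‖ ≤ B) (hW₀ : ∀ᵐ z ∂μ, ‖W z - c‖ ≤ B₀) (hA : ∀ᵐ z ∂μ, ‖A z‖ ≤ α)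
    {r : ℝ} {t : ℂ} (hrt : s + r * α + ‖t‖ * B ≤ 1) (hrt₀ : s + r * α + ‖t‖ * B₀ ≤ 1) {u : ℂ} (hu : ‖u‖ ≤ r) :
    ‖dressLogAt μ ρ₀ σ A W u t - dressLogAt μ ρ₀ σ A W 0 t‖ ≤ 2 * α * B₀ * Real.exp (6 * (s + r * α + ‖t‖ * B₀)) * ‖t‖ * r := by
  have hr : 0 ≤ r := (norm_nonneg u).trans hu
  have h := norm_dressLogAt_sub_le (u' := 0) hρ hρ0 hP hσm hWm hAm hσ hW hW₀ hA hrt hrt₀ hu (by simpa using hr)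
  rw [sub_zero] at h
  exact h.trans (mul_le_mul_of_nonneg_left hu (by
    have hB₀ : 0 ≤ B₀ := nonneg_of_ae_norm_le'' hP hW₀
    have hα : 0 ≤ α := nonneg_of_ae_norm_le'' hP hA
    positivity))

end Literature.MathematicalPhysics.QuantumFieldTheory.Balaban1983to89.B16DressedTermBackground

end
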